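import Summits.CriticalPhenomena.SAWScalingLimit.Theorems.SAWDevelopingMapHexConjectureCurveUpgradeDeterministic
import Summits.CriticalPhenomena.SAWScalingLimit.Theorems.SAWDevelopingMapHexConjectureCurveUpgradeLaw
import Summits.CriticalPhenomena.SAWScalingLimit.Theorems.SAWDevelopingMapHexConjectureCurveUpgradeModuli
import Literature.Probability.RandomPlanarGeometry.SLE

/-!
# Curve upgrade, main theorem — range convergence + endpoints + no triple strands ⟹ convergence to
SLE(8/3) (crux `HexConjecture`, line `root-locality-replaces-loewner`, stub `stub_curveUpgrade`)

Main file of the registered stub `stub_curveUpgrade` of the crux skeleton for `HexConjecture`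
(the theorem `Upgrade.curveUpgrade` below has EXACTLY the stub's statement; the registered name
`RootLocality.stub_curveUpgrade` is its one-line alias in `…CurveUpgrade.lean`, landed once the
line's skeleton is registered)
(stmt-CriticalPhenomena-0808, Duminil-Copin–Smirnov 2012 Conjecture 1: critical hexagonal SAW ⇒
chordal SLE(8/3)), line `root-locality-replaces-loewner`: the ABSTRACT upgrade (all curve families,
no SAW input). If `Γ` is a chordal SLE_{8/3} curve of the Dobrushin domain `(D; a, b)`, the random
curve classes `X δ` are eventually a.e.-measurable, their RANGES converge in law (Hausdorff metric
on `NonemptyCompacts ℂ`) to the range of `Γ`, their endpoints are deterministic and tend to `a`,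
`b`, and `(ε, ℓ)`-triple strands die in law (`∀ ℓ η > 0 ∃ ε > 0`, eventually
`P δ {triple strand} ≤ η`), then `X δ → SLE_{8/3}` in law in `CurveClass ℂ`
(`ConvergesInLawToSLE (8/3) D X P`, with the given `Γ`).

## Proof (parts: `…CurveUpgradeCrossing/Projection/Deterministic/Law/Moduli.lean`)

No tightness and no uniqueness-in-law are needed: the limit is identified with the GIVEN `Γ`
through the open-set half of the portmanteau theorem (`Upgrade.tendstoLaw_curve_of_open_transfer`,
part 2: normalise the laws, push to ranges, `liminf` of open sets, un-normalise). The transfer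
hypothesis of that theorem is `Upgrade.open_transfer` below: given an open `G ⊆ CurveClass ℂ` and
`θ > 0`, the SLE law is carried by simple arcs from `a` to `b` (`Upgrade.ae_exists_simple_rep`,
Rohde–Schramm), and four exhaustions (`Upgrade.exists_measure_le_add_of_subset_iUnion`) choose, on a
subset `𝒟 ⊆ G` of almost full measure in `G`, UNIFORM data: a margin `ball γ ρ ⊆ G`, a continuity
scale `H` of a simple representative `η` for `ρ/2`, a separation `d` of `η` at scale `H/2`, then —
AFTER invoking the triple-strand hypothesis at `ℓ = d/2` to get its `ε_T` — a Hausdorff scale `ε`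
with injectivity/continuity moduli making `3ε + r₁ ≤ min (ε_T/2, d/4, ρ/4)`. The open set of
compacts is `O = ⋃_{γ ∈ 𝒟} ball (range γ) ε`. If `range (X δ ω) ∈ O` and the endpoints of `X δ ω`
are `ε`-close to `a, b` (true for small `δ`), the deterministic lemma
`Upgrade.dist_le_or_tripleStrand` (part 1) puts `X δ ω` in `ball γ ρ ⊆ G` unless it has an
`(ε_T, ℓ)`-triple strand (`Upgrade.mem_or_tripleStrand`); so
`P δ {range ∈ O} ≤ P δ {X δ ∈ G} + P δ {triple strand} ≤ P δ {X δ ∈ G} + θ` eventually.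
Inputs from the tree: `isProbabilityMeasure_preWienerMeasure'`, `IsSLELaw.ae_simple` /
`ae_isSimpleTrace_sleTrace_of_le_four_holds` (Rohde–Schramm Thm. 6.1), `IsSLELaw.ae_endpoints`,
`CurveClass.hausdorffDist_range_le_dist`, Mathlib's portmanteau theorem. No undischarged named fact.
-/

noncomputable section

open MeasureTheory Filter Topology Set Metric
open scoped ENNReal NNReal unitInterval

namespace Summit.CriticalPhenomena.SAWScalingLimit.Theorems.HexConjecture.RootLocality

open Literature.Probability.RandomPlanarGeometry Literature.Probability.Process

namespace Upgrade

/-- **Pointwise transfer** (deterministic): with the uniform data of the module docstring for a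
simple representative `η` of a class `γ` with `ball γ ρ ⊆ G`, a curve `c` whose range is within
Hausdorff distance `< ε` of the range of `η` and whose endpoints are `ε`-close to `η 0`, `η 1`
either has its class in `G` or has an `(ε_T, ℓ)`-triple strand (`dist_le_or_tripleStrand`).
[folklore] -/
theorem mem_or_tripleStrand {G : Set (CurveClass ℂ)} {η c : Curve ℂ} {ρ H d τ r₁ ε εT ℓ : ℝ}
    (hball : ball (CurveClass.mk η) ρ ⊆ G)
    (hoscH : ∀ u v : I, dist u v ≤ H → dist (η u) (η v) ≤ ρ / 2)
    (hsep : ∀ u v : I, H / 2 ≤ dist u v → d ≤ dist (η u) (η v))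
    (hoscτ : ∀ u v : I, dist u v ≤ τ → dist (η u) (η v) ≤ r₁)
    (hinj : ∀ u v : I, dist (η u) (η v) ≤ 3 * ε → dist u v ≤ τ)
    (hε : 0 < ε) (hH : 0 < H) (hsum : ε + ε + r₁ + ρ / 2 < ρ) (hεT : 2 * (ε + ε + r₁) ≤ εT)
    (hℓ : ℓ ≤ d - 2 * (ε + ε + r₁)) (hhaus : hausdorffDist c.range η.range < ε)
    (h0 : dist (c 0) (η 0) ≤ ε) (h1 : dist (c 1) (η 1) ≤ ε) :
    CurveClass.mk c ∈ G ∨ ∃ s t : Fin 3 → I, (∀ i, s i ≤ t i) ∧ t 0 < s 1 ∧ t 1 < s 2 ∧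
      (∀ i, ℓ ≤ diam ((⇑c) '' Icc (s i) (t i))) ∧
      ∀ i j, hausdorffDist ((⇑c) '' Icc (s i) (t i)) ((⇑c) '' Icc (s j) (t j)) ≤ εT := by
  have hnear : ∀ t : I, ∃ u : I, dist (c t) (η u) ≤ ε := by
    intro t
    have hfin : hausdorffEDist c.range η.range ≠ ⊤ :=
      CurveClass.hausdorffEDist_range_ne_top (CurveClass.mk c) (CurveClass.mk η)
    obtain ⟨y, ⟨u, rfl⟩, hy⟩ := exists_dist_lt_of_hausdorffDist_lt (Curve.mem_range.2 ⟨t, rfl⟩)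
      hhaus hfin
    exact ⟨u, hy.le⟩
  have hinj' : ∀ u v : I, dist (η u) (η v) ≤ 2 * ε + ε → dist u v ≤ τ := fun u v huv ↦
    hinj u v (by linarith)
  rcases dist_le_or_tripleStrand c η ε ε τ r₁ H (ρ / 2) d hε hH hnear h0 h1 hinj' hoscτ hoscH hsep
    with hle | ⟨s, t, hst, h01, h12, hdiam, hHd⟩
  · left
    apply hball
    rw [mem_ball, CurveClass.dist_mk_mk]
    linarith
  · right
    exact ⟨s, t, hst, h01, h12, fun i ↦ hℓ.trans (hdiam i), fun i j ↦ (hHd i j).trans hεT⟩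

variable {Ω : ℝ → Type} [∀ δ, MeasurableSpace (Ω δ)]

/-- **The open-set transfer for the stub** (the hypothesis of `tendstoLaw_curve_of_open_transfer`):
see the module docstring for the four exhaustions and the choice of `O`. [folklore] -/
theorem open_transfer (D : DobrushinDomain) (X : ∀ δ, Ω δ → CurveClass ℂ) (P : ∀ δ, Measure (Ω δ))
    (Γ : (ℝ≥0 → ℝ) → CurveClass ℂ) (src tgt : ℝ → ℂ) (hΓ : IsSLECurve ((8 : ℝ≥0) / 3) D Γ)
    (hsrc : ∀ δ ω, (X δ ω).source = src δ) (htgt : ∀ δ ω, (X δ ω).target = tgt δ)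
    (hsrc' : Tendsto src (𝓝[>] (0 : ℝ)) (𝓝 (D.pt 0)))
    (htgt' : Tendsto tgt (𝓝[>] (0 : ℝ)) (𝓝 (D.pt 1)))
    (hT : ∀ ℓ : ℝ, 0 < ℓ → ∀ η : ℝ, 0 < η → ∃ ε : ℝ, 0 < ε ∧ ∀ᶠ δ : ℝ in 𝓝[>] (0 : ℝ),
      P δ {ω | ∃ c : Curve ℂ, CurveClass.mk c = X δ ω ∧ ∃ s t : Fin 3 → I,
        (∀ i, s i ≤ t i) ∧ t 0 < s 1 ∧ t 1 < s 2 ∧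
        (∀ i, ℓ ≤ diam ((⇑c) '' Icc (s i) (t i))) ∧
        ∀ i j, hausdorffDist ((⇑c) '' Icc (s i) (t i)) ((⇑c) '' Icc (s j) (t j)) ≤ ε} ≤
        ENNReal.ofReal η)
    (G : Set (CurveClass ℂ)) (hG : IsOpen G) (θ : ℝ≥0∞) (hθ : 0 < θ) :
    ∃ O : Set (TopologicalSpace.NonemptyCompacts ℂ), IsOpen O ∧
      preWienerMeasure.map Γ G ≤ preWienerMeasure.map Γ
        {γ | (⟨⟨γ.range, γ.isCompact_range⟩, γ.range_nonempty⟩ :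
          TopologicalSpace.NonemptyCompacts ℂ) ∈ O} + θ ∧
      ∀ᶠ δ : ℝ in 𝓝[>] (0 : ℝ), P δ {ω | (⟨⟨(X δ ω).range, (X δ ω).isCompact_range⟩,
        (X δ ω).range_nonempty⟩ : TopologicalSpace.NonemptyCompacts ℂ) ∈ O} ≤
        P δ (X δ ⁻¹' G) + θ := by
  haveI : IsProbabilityMeasure preWienerMeasure := isProbabilityMeasure_preWienerMeasure'
  set μ : Measure (CurveClass ℂ) := preWienerMeasure.map Γ with hμ
  haveI : IsProbabilityMeasure μ := Measure.isProbabilityMeasure_map hΓ.aemeasurable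
  set a : ℂ := D.pt 0 with ha
  set b : ℂ := D.pt 1 with hb
  -- a real error budget `t` with `5 t ≤ θ`
  set θ' : ℝ≥0∞ := min θ 1 with hθ'
  have hθ'θ : θ' ≤ θ := min_le_left _ _
  have hθ'top : θ' ≠ ⊤ := ne_top_of_le_ne_top ENNReal.one_ne_top (min_le_right _ _)
  have hθ'pos : 0 < θ' := lt_min hθ zero_lt_one
  set t : ℝ := θ'.toReal / 8 with htdef
  have htpos : 0 < t := by
    have : 0 < θ'.toReal := ENNReal.toReal_pos hθ'pos.ne' hθ'top
    positivity
  have hTpos : (0 : ℝ≥0∞) < ENNReal.ofReal t := ENNReal.ofReal_pos.2 htpos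
  have hsumθ : ENNReal.ofReal t + ENNReal.ofReal t + ENNReal.ofReal t + ENNReal.ofReal t +
      ENNReal.ofReal t ≤ θ := by
    rw [← ENNReal.ofReal_add htpos.le htpos.le, ← ENNReal.ofReal_add (by positivity) htpos.le,
      ← ENNReal.ofReal_add (by positivity) htpos.le, ← ENNReal.ofReal_add (by positivity) htpos.le]
    refine le_trans ?_ hθ'θ
    rw [← ENNReal.ofReal_toReal hθ'top]
    exact ENNReal.ofReal_le_ofReal (by rw [htdef]; linarith [ENNReal.toReal_nonneg (a := θ')])
  -- the null set of classes without a simple representative from `a` to `b`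
  set N : Set (CurveClass ℂ) :=
    {γ | ¬ ∃ η : Curve ℂ, CurveClass.mk η = γ ∧ η.IsSimple ∧ η 0 = a ∧ η 1 = b} with hN
  have hN0 : μ N = 0 := by
    have h := ae_exists_simple_rep ((8 : ℝ≥0) / 3) D Γ (by positivity)
      (by rw [div_le_iff₀ (by norm_num : (0 : ℝ≥0) < 3)]; norm_num) hΓ
    rwa [ae_iff] at h
  -- exhaustion 1: a margin `ρ`
  let A : ℕ → Set (CurveClass ℂ) := fun k ↦ {γ | ball γ (1 / ((k : ℝ) + 1)) ⊆ G}
  have hAmem : ∀ k γ, γ ∈ A k ↔ ball γ (1 / ((k : ℝ) + 1)) ⊆ G := fun k γ ↦ Iff.rfl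
  have hAmono : Monotone A := fun k l hkl γ hγ ↦ by
    rw [hAmem] at hγ ⊢
    refine (ball_subset_ball ?_).trans hγ
    exact one_div_le_one_div_of_le (by positivity) (by exact_mod_cast Nat.add_le_add_right hkl 1)
  have hGA : G ⊆ N ∪ ⋃ k, A k := fun γ hγ ↦ by
    obtain ⟨r, hr, hrG⟩ := Metric.isOpen_iff.1 hG γ hγ
    obtain ⟨k, hk⟩ := exists_nat_one_div_lt hr
    exact Or.inr (mem_iUnion.2 ⟨k, (hAmem k γ).2 ((ball_subset_ball hk.le).trans hrG)⟩)
  obtain ⟨k₁, hk₁⟩ := exists_measure_le_add_of_subset_iUnion μ hAmono hN0 hGA hTpos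
  set ρ : ℝ := 1 / ((k₁ : ℝ) + 1) with hρdef
  have hρ : 0 < ρ := by positivity
  -- exhaustion 2: a continuity scale `H` for `ρ / 2`
  let B : ℕ → Set (CurveClass ℂ) := fun k ↦ {γ | γ ∈ A k₁ ∧ ∃ η : Curve ℂ, CurveClass.mk η = γ ∧
    η.IsSimple ∧ η 0 = a ∧ η 1 = b ∧
    ∀ u v : I, dist u v ≤ 1 / ((k : ℝ) + 1) → dist (η u) (η v) ≤ ρ / 2}
  have hBmem : ∀ k γ, γ ∈ B k ↔ γ ∈ A k₁ ∧ ∃ η : Curve ℂ, CurveClass.mk η = γ ∧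
      η.IsSimple ∧ η 0 = a ∧ η 1 = b ∧
      ∀ u v : I, dist u v ≤ 1 / ((k : ℝ) + 1) → dist (η u) (η v) ≤ ρ / 2 := fun k γ ↦ Iff.rfl
  have hBmono : Monotone B := fun k l hkl γ hγ ↦ by
    rw [hBmem] at hγ ⊢
    obtain ⟨hγA, η, h1, h2, h3, h4, h5⟩ := hγ
    refine ⟨hγA, η, h1, h2, h3, h4, fun u v huv ↦ h5 u v (huv.trans ?_)⟩
    exact one_div_le_one_div_of_le (by positivity) (by exact_mod_cast Nat.add_le_add_right hkl 1)
  have hAB : A k₁ ⊆ N ∪ ⋃ k, B k := fun γ hγ ↦ by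
    by_cases hγN : γ ∈ N
    · exact Or.inl hγN
    · simp only [hN, mem_setOf_eq, not_not] at hγN
      obtain ⟨η, h1, h2, h3, h4⟩ := hγN
      obtain ⟨h, hh, hosc⟩ := exists_osc_modulus η (half_pos hρ)
      obtain ⟨k, hk⟩ := exists_nat_one_div_lt hh
      exact Or.inr (mem_iUnion.2 ⟨k, (hBmem k γ).2
        ⟨hγ, η, h1, h2, h3, h4, fun u v huv ↦ hosc u v (huv.trans hk.le)⟩⟩)
  obtain ⟨k₂, hk₂⟩ := exists_measure_le_add_of_subset_iUnion μ hBmono hN0 hAB hTpos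
  set H : ℝ := 1 / ((k₂ : ℝ) + 1) with hHdef
  have hH : 0 < H := by positivity
  -- exhaustion 3: a separation `d` at scale `H / 2`
  let C : ℕ → Set (CurveClass ℂ) := fun k ↦ {γ | γ ∈ A k₁ ∧ ∃ η : Curve ℂ, CurveClass.mk η = γ ∧
    η.IsSimple ∧ η 0 = a ∧ η 1 = b ∧
    (∀ u v : I, dist u v ≤ H → dist (η u) (η v) ≤ ρ / 2) ∧
    ∀ u v : I, H / 2 ≤ dist u v → 1 / ((k : ℝ) + 1) ≤ dist (η u) (η v)}
  have hCmem : ∀ k γ, γ ∈ C k ↔ γ ∈ A k₁ ∧ ∃ η : Curve ℂ, CurveClass.mk η = γ ∧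
      η.IsSimple ∧ η 0 = a ∧ η 1 = b ∧
      (∀ u v : I, dist u v ≤ H → dist (η u) (η v) ≤ ρ / 2) ∧
      ∀ u v : I, H / 2 ≤ dist u v → 1 / ((k : ℝ) + 1) ≤ dist (η u) (η v) := fun k γ ↦ Iff.rfl
  have hCmono : Monotone C := fun k l hkl γ hγ ↦ by
    rw [hCmem] at hγ ⊢
    obtain ⟨hγA, η, h1, h2, h3, h4, h5, h6⟩ := hγ
    refine ⟨hγA, η, h1, h2, h3, h4, h5, fun u v huv ↦ le_trans ?_ (h6 u v huv)⟩
    exact one_div_le_one_div_of_le (by positivity) (by exact_mod_cast Nat.add_le_add_right hkl 1)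
  have hBC : B k₂ ⊆ N ∪ ⋃ k, C k := fun γ hγ ↦ by
    rw [hBmem] at hγ
    obtain ⟨hγA, η, h1, h2, h3, h4, h5⟩ := hγ
    obtain ⟨d, hd, hsep⟩ := exists_sep_modulus h2 (half_pos hH)
    obtain ⟨k, hk⟩ := exists_nat_one_div_lt hd
    exact Or.inr (mem_iUnion.2 ⟨k, (hCmem k γ).2
      ⟨hγA, η, h1, h2, h3, h4, h5, fun u v huv ↦ hk.le.trans (hsep u v huv)⟩⟩)
  obtain ⟨k₃, hk₃⟩ := exists_measure_le_add_of_subset_iUnion μ hCmono hN0 hBC hTpos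
  set d : ℝ := 1 / ((k₃ : ℝ) + 1) with hddef
  have hd : 0 < d := by positivity
  -- the triple-strand scale `ε_T` at `ℓ = d / 2`
  obtain ⟨εT, hεT, hevT⟩ := hT (d / 2) (half_pos hd) t htpos
  set e : ℝ := min (εT / 2) (min (d / 4) (ρ / 4)) with hedef
  have he : 0 < e := lt_min (half_pos hεT) (lt_min (by positivity) (by positivity))
  have heT : e ≤ εT / 2 := min_le_left _ _
  have hed : e ≤ d / 4 := (min_le_right _ _).trans (min_le_left _ _)
  have heρ : e ≤ ρ / 4 := (min_le_right _ _).trans (min_le_right _ _)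
  -- exhaustion 4: the Hausdorff scale `ε`
  let ek : ℕ → ℝ := fun k ↦ min (1 / ((k : ℝ) + 1)) (e / 3)
  have hekpos : ∀ k, 0 < ek k := fun k ↦ lt_min (by positivity) (by positivity)
  have hekmono : ∀ k l, k ≤ l → ek l ≤ ek k := fun k l hkl ↦
    min_le_min (one_div_le_one_div_of_le (by positivity)
      (by exact_mod_cast Nat.add_le_add_right hkl 1)) le_rfl
  let Dk : ℕ → Set (CurveClass ℂ) := fun k ↦ {γ | γ ∈ A k₁ ∧ ∃ η : Curve ℂ, CurveClass.mk η = γ ∧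
    η.IsSimple ∧ η 0 = a ∧ η 1 = b ∧
    (∀ u v : I, dist u v ≤ H → dist (η u) (η v) ≤ ρ / 2) ∧
    (∀ u v : I, H / 2 ≤ dist u v → d ≤ dist (η u) (η v)) ∧
    ∃ τ : ℝ, (∀ u v : I, dist u v ≤ τ → dist (η u) (η v) ≤ e / 3) ∧
      ∀ u v : I, dist (η u) (η v) ≤ 3 * ek k → dist u v ≤ τ}
  have hDmem : ∀ k γ, γ ∈ Dk k ↔ γ ∈ A k₁ ∧ ∃ η : Curve ℂ, CurveClass.mk η = γ ∧
      η.IsSimple ∧ η 0 = a ∧ η 1 = b ∧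
      (∀ u v : I, dist u v ≤ H → dist (η u) (η v) ≤ ρ / 2) ∧
      (∀ u v : I, H / 2 ≤ dist u v → d ≤ dist (η u) (η v)) ∧
      ∃ τ : ℝ, (∀ u v : I, dist u v ≤ τ → dist (η u) (η v) ≤ e / 3) ∧
        ∀ u v : I, dist (η u) (η v) ≤ 3 * ek k → dist u v ≤ τ := fun k γ ↦ Iff.rfl
  have hDmono : Monotone Dk := fun k l hkl γ hγ ↦ by
    rw [hDmem] at hγ ⊢
    obtain ⟨hγA, η, h1, h2, h3, h4, h5, h6, τ, h7, h8⟩ := hγ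
    refine ⟨hγA, η, h1, h2, h3, h4, h5, h6, τ, h7, fun u v huv ↦ h8 u v (huv.trans ?_)⟩
    linarith [hekmono k l hkl]
  have hCD : C k₃ ⊆ N ∪ ⋃ k, Dk k := fun γ hγ ↦ by
    rw [hCmem] at hγ
    obtain ⟨hγA, η, h1, h2, h3, h4, h5, h6⟩ := hγ
    obtain ⟨τ, hτ, hoscτ⟩ := exists_osc_modulus η (by positivity : 0 < e / 3)
    obtain ⟨d', hd', hinj⟩ := exists_inj_modulus h2 hτ
    obtain ⟨k, hk⟩ := exists_nat_one_div_lt (by positivity : 0 < d' / 3)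
    refine Or.inr (mem_iUnion.2 ⟨k, (hDmem k γ).2 ⟨hγA, η, h1, h2, h3, h4, h5, h6, τ, hoscτ,
      fun u v huv ↦ hinj u v (huv.trans ?_)⟩⟩)
    have : ek k ≤ 1 / ((k : ℝ) + 1) := min_le_left _ _
    linarith
  obtain ⟨k₄, hk₄⟩ := exists_measure_le_add_of_subset_iUnion μ hDmono hN0 hCD hTpos
  set ε : ℝ := ek k₄ with hεdef
  have hε : 0 < ε := hekpos k₄
  have hεe : ε ≤ e / 3 := min_le_right _ _
  -- the open set of compacts
  set Rg : CurveClass ℂ → TopologicalSpace.NonemptyCompacts ℂ :=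
    fun γ ↦ ⟨⟨γ.range, γ.isCompact_range⟩, γ.range_nonempty⟩ with hRg
  have hRdist : ∀ γ γ' : CurveClass ℂ, dist (Rg γ) (Rg γ') = hausdorffDist γ.range γ'.range :=
    fun γ γ' ↦ by rw [Metric.NonemptyCompacts.dist_eq]; rfl
  set O : Set (TopologicalSpace.NonemptyCompacts ℂ) := ⋃ γ ∈ Dk k₄, ball (Rg γ) ε with hO
  refine ⟨O, isOpen_biUnion fun _ _ ↦ isOpen_ball, ?_, ?_⟩
  · -- `μ G ≤ μ (Rg ⁻¹ O) + θ`
    have hDO : Dk k₄ ⊆ {γ | Rg γ ∈ O} := fun γ hγ ↦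
      mem_biUnion hγ (mem_ball_self hε)
    calc μ G ≤ μ (Dk k₄) + ENNReal.ofReal t + ENNReal.ofReal t + ENNReal.ofReal t +
          ENNReal.ofReal t := by
          calc μ G ≤ μ (A k₁) + ENNReal.ofReal t := hk₁
            _ ≤ μ (B k₂) + ENNReal.ofReal t + ENNReal.ofReal t := by gcongr
            _ ≤ μ (C k₃) + ENNReal.ofReal t + ENNReal.ofReal t + ENNReal.ofReal t := by gcongr
            _ ≤ _ := by gcongr
      _ ≤ μ {γ | Rg γ ∈ O} + (ENNReal.ofReal t + ENNReal.ofReal t + ENNReal.ofReal t +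
          ENNReal.ofReal t + ENNReal.ofReal t) := by
          have hDO' := measure_mono (μ := μ) hDO
          rw [show μ {γ | Rg γ ∈ O} + (ENNReal.ofReal t + ENNReal.ofReal t + ENNReal.ofReal t +
            ENNReal.ofReal t + ENNReal.ofReal t) = μ {γ | Rg γ ∈ O} + ENNReal.ofReal t +
            ENNReal.ofReal t + ENNReal.ofReal t + ENNReal.ofReal t + ENNReal.ofReal t by ring]
          exact le_add_right (by gcongr)
      _ ≤ μ {γ | Rg γ ∈ O} + θ := add_le_add le_rfl hsumθ
  · -- eventually `P δ {range ∈ O} ≤ P δ (X δ ⁻¹ G) + θ`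
    have hev0 : ∀ᶠ δ : ℝ in 𝓝[>] (0 : ℝ), dist (src δ) a < ε := Metric.tendsto_nhds.1 hsrc' ε hε
    have hev1 : ∀ᶠ δ : ℝ in 𝓝[>] (0 : ℝ), dist (tgt δ) b < ε := Metric.tendsto_nhds.1 htgt' ε hε
    filter_upwards [hevT, hev0, hev1] with δ hδT hδ0 hδ1
    -- the event inclusion
    have hincl : {ω | Rg (X δ ω) ∈ O} ⊆ X δ ⁻¹' G ∪ {ω | ∃ c : Curve ℂ, CurveClass.mk c = X δ ω ∧
        ∃ s t : Fin 3 → I, (∀ i, s i ≤ t i) ∧ t 0 < s 1 ∧ t 1 < s 2 ∧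
        (∀ i, d / 2 ≤ diam ((⇑c) '' Icc (s i) (t i))) ∧
        ∀ i j, hausdorffDist ((⇑c) '' Icc (s i) (t i)) ((⇑c) '' Icc (s j) (t j)) ≤ εT} := by
      intro ω hω
      simp only [hO, mem_setOf_eq, mem_iUnion, mem_ball, exists_prop] at hω
      obtain ⟨γ, hγ, hdist⟩ := hω
      rw [hDmem] at hγ
      obtain ⟨hγA, η, hηγ, -, hη0, hη1, hoscH, hsep, τ, hoscτ, hinj⟩ := hγ
      obtain ⟨c, hc⟩ := CurveClass.surjective_mk (X δ ω)
      have hball : ball (CurveClass.mk η) ρ ⊆ G := by rw [hηγ]; exact (hAmem k₁ γ).1 hγA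
      have hhaus : hausdorffDist c.range η.range < ε := by
        have h := hdist
        rw [hRdist, ← hc, ← hηγ] at h
        exact h
      have h0 : dist (c 0) (η 0) ≤ ε := by
        have : c 0 = src δ := by rw [← hsrc δ ω, ← hc]; rfl
        rw [this, hη0]; exact hδ0.le
      have h1 : dist (c 1) (η 1) ≤ ε := by
        have : c 1 = tgt δ := by rw [← htgt δ ω, ← hc]; rfl
        rw [this, hη1]; exact hδ1.le
      rcases mem_or_tripleStrand (εT := εT) (ℓ := d / 2) hball hoscH hsep hoscτ hinj hε hH
        (by linarith) (by linarith) (by linarith) hhaus h0 h1 with hmem | hstr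
      · exact Or.inl (by rw [mem_preimage, ← hc]; exact hmem)
      · exact Or.inr ⟨c, hc, hstr⟩
    calc P δ {ω | Rg (X δ ω) ∈ O} ≤ P δ (X δ ⁻¹' G) + P δ {ω | ∃ c : Curve ℂ,
          CurveClass.mk c = X δ ω ∧ ∃ s t : Fin 3 → I, (∀ i, s i ≤ t i) ∧ t 0 < s 1 ∧ t 1 < s 2 ∧
          (∀ i, d / 2 ≤ diam ((⇑c) '' Icc (s i) (t i))) ∧
          ∀ i j, hausdorffDist ((⇑c) '' Icc (s i) (t i)) ((⇑c) '' Icc (s j) (t j)) ≤ εT} :=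
          (measure_mono hincl).trans (measure_union_le _ _)
      _ ≤ P δ (X δ ⁻¹' G) + ENNReal.ofReal t := add_le_add le_rfl hδT
      _ ≤ P δ (X δ ⁻¹' G) + θ := add_le_add le_rfl (le_trans (by
          have h5 := hsumθ
          calc ENNReal.ofReal t ≤ ENNReal.ofReal t + ENNReal.ofReal t + ENNReal.ofReal t +
              ENNReal.ofReal t + ENNReal.ofReal t := by
                rw [add_assoc, add_assoc, add_assoc]; exact le_self_add
            _ ≤ θ := h5) le_rfl)

/-- **The curve upgrade** (main theorem of `stub_curveUpgrade`, line `root-locality-replaces-loewner`;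
registered helper `curveUpgrade`, whose statement IS the stub's statement — the registered stub
`RootLocality.stub_curveUpgrade` is the one-line alias of this theorem in `…CurveUpgrade.lean`):
`CurveUpgrade` — if `Γ` is a chordal SLE_{8/3} curve of `D`, the random curve classes `X δ` are
eventually a.e.-measurable, their ranges converge in law to the range of `Γ`, their endpoints are
deterministic and tend to the marks, and triple strands die in law, then `X δ → SLE_{8/3}` in law
in `CurveClass ℂ` (with the same `Γ`; `tendstoLaw_curve_of_open_transfer` fed by `open_transfer`).
[folklore] -/
theorem curveUpgrade : ∀ (D : Literature.Probability.RandomPlanarGeometry.DobrushinDomain) (Ω : ℝ → Type) [∀ δ, MeasurableSpace (Ω δ)] (X : ∀ δ, Ω δ → Literature.Probability.RandomPlanarGeometry.CurveClass ℂ) (P : ∀ δ, MeasureTheory.Measure (Ω δ)) (Γ : (NNReal → ℝ) → Literature.Probability.RandomPlanarGeometry.CurveClass ℂ) (src tgt : ℝ → ℂ), Literature.Probability.RandomPlanarGeometry.IsSLECurve ((8 : NNReal) / 3) D Γ → (∀ᶠ δ : ℝ in nhdsWithin (0 : ℝ) (Set.Ioi 0), AEMeasurable (X δ) (P δ)) →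 Literature.Probability.RandomPlanarGeometry.TendstoLaw (fun δ ω => (⟨⟨(X δ ω).range, (X δ ω).isCompact_range⟩, (X δ ω).range_nonempty⟩ : TopologicalSpace.NonemptyCompacts ℂ)) P (fun ω => (⟨⟨(Γ ω).range, (Γ ω).isCompact_range⟩, (Γ ω).range_nonempty⟩ : TopologicalSpace.NonemptyCompacts ℂ)) Literature.Probability.Process.preWienerMeasure → (∀ δ ω, (X δ ω).source = src δ) → (∀ δ ω, (X δ ω).target = tgt δ) → Filter.Tendsto src (nhdsWithin (0 : ℝ) (Set.Ioi 0)) (nhds (D.pt 0)) → Filter.Tendsto tgt (nhdsWithin (0 : ℝ) (Set.Ioi 0)) (nhds (D.pt 1)) → (∀ ℓ : ℝ, 0 < ℓ → ∀ η : ℝ, 0 < η → ∃ ε : ℝ, 0 < ε ∧ ∀ᶠ δ : ℝ in nhdsWithin (0 : ℝ) (Set.Ioi 0), P δ {ω | ∃ c : Literature.Probability.RandomPlanarGeometry.Curve ℂ, Literature.Probability.RandomPlanarGeometry.CurveClass.mk c = X δ ω ∧ ∃ s t : Fin 3 → unitInterval, (∀ i, s i ≤ t i) ∧ t 0 < s 1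 ∧ t 1 < s 2 ∧ (∀ i, ℓ ≤ Metric.diam ((⇑c) '' Set.Icc (s i) (t i))) ∧ ∀ i j, Metric.hausdorffDist ((⇑c) '' Set.Icc (s i) (t i)) ((⇑c) '' Set.Icc (s j) (t j)) ≤ ε} ≤ ENNReal.ofReal η) → Literature.Probability.RandomPlanarGeometry.ConvergesInLawToSLE ((8 : NNReal) / 3) D X P := by
  intro D Ω _ X P Γ src tgt hΓ hX hlaw hsrc htgt hsrc' htgt' hT
  refine ⟨Γ, hΓ, hX, ?_⟩
  exact tendstoLaw_curve_of_open_transfer Ω X P Γ hΓ.aemeasurable hX hlaw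
    (open_transfer D X P Γ src tgt hΓ hsrc htgt hsrc' htgt' hT)

end Upgrade

end Summit.CriticalPhenomena.SAWScalingLimit.Theorems.HexConjecture.RootLocality
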